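import Summits.FinalStateConjecture.FinalStateConjecture.Theorems.EIHFluxBalanceInertialRecessionStubIdentificationCompare
import Summits.FinalStateConjecture.FinalStateConjecture.Theorems.EIHFluxBalanceInertialRecessionStubQuasiStationarityWeights

/-!
# Route EIHFluxBalance — `InertialRecession`, line `sublinear-is-free-clean-window-charges`:
# rates, scales and thresholds of the identification (stub `stub_identification`, part A5c-1)

Helper file (`--supports stmt-FinalStateConjecture-10166`) for the crux
`Summit.FinalStateConjecture.FinalStateConjecture.Theses.EIHFluxBalance.InertialRecession`.

Bookkeeping inputs of the assembly of `stub_identification`: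
* `opNorm_defect_le_of_rates` — the modulation defect `‖D painted − D frozen‖` of a hole at a slab
  point at lab distance `d ≥ max 1 (2|a|)`, bounded by the slaving RATES
  `r(t) = ‖(Λe₀)˙(t)‖ + [a ≠ 0] ‖(Λe₃)˙(t)‖` and `‖ξ̇(t) − v(t)‖` (stabiliser correction
  `exists_stabiliser_correction` inside `opNorm_fderiv_painted_sub_frozen_le`): rotation-blind;
* `tendsto_boostRate_zero`, `tendsto_drift_zero` — under the slaving clause both rates tend to `0`;
* `slowScale` lemmas — for `u → 0`, `u ≥ 0`, an explicit scale `r → ∞` with `u r^p → 0`;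
* `toRealMinOne` lemmas — the real-valued deviation size `εf = (min F 1).toReal` of an
  `ℝ≥0∞`-valued `F → 0`.
[cite: LandauLifshitz1975, §96]
-/

set_option linter.dupNamespace false
-- instance search on the nested operator spaces `E4 →L[ℝ] E4 →L[ℝ] ℝ` is deep
set_option maxSynthPendingDepth 3

noncomputable section

namespace Summit.FinalStateConjecture.FinalStateConjecture.Theorems.SublinearIsFree.ChargeModel

open scoped BigOperators Topology ContDiff ENNReal
open Filter Set Metric Function Literature.Geometry.Lorentzian
open Summit.FinalStateConjecture.FinalStateConjecture.Theorems
open Summit.FinalStateConjecture.FinalStateConjecture.Theorems.InertialRecession.Negative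
open SublinearIsFree.QuasiStationarity SublinearIsFree.Slaving

/-! ### The defect in terms of the slaving rates -/

-- operator-norm instance paths on form-valued maps are slow to unify
set_option synthInstance.maxHeartbeats 200000 in
/-- **The modulation defect bounded by the slaving rates.** With universal `B₀, B₁ ≥ 0`: for a `C¹`
motion with `|(Λ(t)e₀)⁰| ≤ γ`, a `C¹` centre, and a slab point `x` (`x⁰ = t`) at lab distance
`d = ‖x̃ − ξ(t)‖ ≥ max 1 (2|a|)`,
`‖D(painted)(x) − D(frozen_t)(x)‖ ≤ |M| G² ((B₁G + 2B₀)(4G r(t))/d + B₁ G ‖ξ̇(t) − v(t)‖/d²)`,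
`G = 1 + 3γ`, `r(t) = ‖(Λe₀)˙(t)‖ + [a ≠ 0]‖(Λe₃)˙(t)‖`, `v = (Λe₀)~/(Λe₀)⁰`. [cite: KerrSchild1965, §3] -/
theorem opNorm_defect_le_of_rates :
    ∃ B₀ B₁ : ℝ, 0 ≤ B₀ ∧ 0 ≤ B₁ ∧ ∀ (M a γ : ℝ) (Λ : ℝ → lorentzGroup) (ξ : ℝ → E3) (t : ℝ) (x : E4),
      ContDiff ℝ 1 (fun s ↦ ((Λ s : E4 ≃L[ℝ] E4) : E4 →L[ℝ] E4)) → ContDiff ℝ 1 ξ →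
      |((Λ t : E4 ≃L[ℝ] E4) (E4.basisVector 0)) 0| ≤ γ → x 0 = t →
      max 1 (2 * |a|) ≤ ‖E4.spatial x - ξ t‖ →
      ‖fderiv ℝ (fun y : E4 ↦ boostedKerrBilin (Λ (y 0)) (E4.ofTimeSpace (y 0) (ξ (y 0))) M a y) x -
        fderiv ℝ (boostedKerrBilin (Λ t) (E4.ofTimeSpace t (ξ t)) M a) x‖ ≤
        |M| * (1 + 3 * γ) ^ 2 * ((B₁ * (1 + 3 * γ) + 2 * B₀) * (4 * (1 + 3 * γ) *
          (‖deriv (fun s ↦ (Λ s : E4 ≃L[ℝ] E4) (E4.basisVector 0)) t‖ +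
            if a = 0 then 0 else ‖deriv (fun s ↦ (Λ s : E4 ≃L[ℝ] E4) (E4.basisVector 3)) t‖)) /
            ‖E4.spatial x - ξ t‖ +
          B₁ * (1 + 3 * γ) * ‖deriv ξ t - (((Λ t : E4 ≃L[ℝ] E4) (E4.basisVector 0)) 0)⁻¹ •
            E4.spatial ((Λ t : E4 ≃L[ℝ] E4) (E4.basisVector 0))‖ / ‖E4.spatial x - ξ t‖ ^ 2) := by
  obtain ⟨B₀, B₁, hB₀, hB₁, h⟩ := opNorm_fderiv_painted_sub_frozen_le
  refine ⟨B₀, B₁, hB₀, hB₁, fun M a γ Λ ξ t x hΛ hξ hγ hx hd ↦ ?_⟩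
  have hΛ' : HasDerivAt (fun s ↦ ((Λ s : E4 ≃L[ℝ] E4) : E4 →L[ℝ] E4))
      (deriv (fun s ↦ ((Λ s : E4 ≃L[ℝ] E4) : E4 →L[ℝ] E4)) t) t :=
    (hΛ.differentiable one_ne_zero t).hasDerivAt
  have hp : DifferentiableAt ℝ (fun y ↦ Kerr.bilin M a y - Minkowski.bilin)
      ((((Λ t : E4 ≃L[ℝ] E4).symm : E4 →L[ℝ] E4)) (E4.spaceEmbed (E4.spatial x - ξ t))) :=
    differentiableAt_ksPert_of_le (hd.trans (le_spatialNorm_restPosition (Λ t) _))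
  obtain ⟨SK, hstab, hν⟩ := exists_stabiliser_correction M a γ Λ t hΛ' hγ hp
  have hγ1 : 1 ≤ γ := (one_le_abs_lorentz_apply_zero (Λ t)).trans hγ
  set r : ℝ := ‖deriv (fun s ↦ ((Λ s : E4 ≃L[ℝ] E4) : E4 →L[ℝ] E4)) t (E4.basisVector 0)‖ +
    if a = 0 then 0 else ‖deriv (fun s ↦ ((Λ s : E4 ≃L[ℝ] E4) : E4 →L[ℝ] E4)) t (E4.basisVector 3)‖ with hr
  have hr0 : 0 ≤ r := by rw [hr]; split_ifs <;> positivity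
  have hν0 : 0 ≤ 4 * (1 + 3 * γ) * r := by
    have : 0 ≤ 1 + 3 * γ := by linarith
    positivity
  have hbound := h M a γ Λ ξ t x SK (4 * (1 + 3 * γ) * r) hΛ hξ hγ hx hd hν0 hstab (fun u ↦ by rw [hr]; exact hν u)
  rw [deriv_lorentz_apply_basisVector hΛ' 0, deriv_lorentz_apply_basisVector hΛ' 3]
  exact hbound

/-! ### The slaving rates tend to zero -/

/-- **The boost rate tends to zero under slaving**: from the slaving clause of hole `i`
(`m = 1` for `Λe₀`, and for `Λe₃` when `a ≠ 0`),
`‖(Λe₀)˙(t)‖ + [a ≠ 0]‖(Λe₃)˙(t)‖ → 0`. [folklore] -/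
theorem tendsto_boostRate_zero {Λ : ℝ → lorentzGroup} {a : ℝ}
    (h0 : ∀ m : ℕ, 1 ≤ m → m ≤ 3 → Tendsto (fun t ↦ iteratedDeriv m
      (fun s ↦ ((Λ s : E4 ≃L[ℝ] E4) (E4.basisVector 0))) t) atTop (𝓝 0))
    (h3 : a ≠ 0 → ∀ m : ℕ, 1 ≤ m → m ≤ 3 → Tendsto (fun t ↦ iteratedDeriv m
      (fun s ↦ ((Λ s : E4 ≃L[ℝ] E4) (E4.basisVector 3))) t) atTop (𝓝 0)) :
    Tendsto (fun t ↦ ‖deriv (fun s ↦ (Λ s : E4 ≃L[ℝ] E4) (E4.basisVector 0)) t‖ +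
      if a = 0 then 0 else ‖deriv (fun s ↦ (Λ s : E4 ≃L[ℝ] E4) (E4.basisVector 3)) t‖) atTop (𝓝 0) := by
  have h0' : Tendsto (fun t ↦ ‖deriv (fun s ↦ (Λ s : E4 ≃L[ℝ] E4) (E4.basisVector 0)) t‖) atTop (𝓝 0) := by
    have h := (h0 1 le_rfl (by norm_num)).norm
    simpa only [iteratedDeriv_one, norm_zero] using h
  by_cases ha : a = 0
  · simpa only [ha, if_true, add_zero] using h0'
  · have h3' : Tendsto (fun t ↦ ‖deriv (fun s ↦ (Λ s : E4 ≃L[ℝ] E4) (E4.basisVector 3)) t‖) atTop (𝓝 0) := by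
      have h := (h3 ha 1 le_rfl (by norm_num)).norm
      simpa only [iteratedDeriv_one, norm_zero] using h
    simpa only [ha, if_false, add_zero] using h0'.add h3'

/-- **The drift tends to zero under slaving** (`m = 0` of the second slaving clause):
`‖ξ̇(t) − v(t)‖ → 0`. [folklore] -/
theorem tendsto_drift_zero {Λ : ℝ → lorentzGroup} {ξ : ℝ → E3}
    (h : ∀ m : ℕ, m ≤ 2 → Tendsto (fun t ↦ iteratedDeriv m (fun s ↦ deriv ξ s -
      ((((Λ s : E4 ≃L[ℝ] E4) (E4.basisVector 0)) 0)⁻¹ •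
        E4.spatial ((Λ s : E4 ≃L[ℝ] E4) (E4.basisVector 0)))) t) atTop (𝓝 0)) :
    Tendsto (fun t ↦ ‖deriv ξ t - (((Λ t : E4 ≃L[ℝ] E4) (E4.basisVector 0)) 0)⁻¹ •
      E4.spatial ((Λ t : E4 ≃L[ℝ] E4) (E4.basisVector 0))‖) atTop (𝓝 0) := by
  have h0 := (h 0 (Nat.zero_le 2)).norm
  simpa only [iteratedDeriv_zero, norm_zero] using h0

/-! ### Slow scales -/

/-- The base `b(t) = u(t) + (max t 1)⁻¹` of the slow scale is positive and tends to `0⁺`. [folklore] -/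
theorem slowBase_pos {u : ℝ → ℝ} (hu0 : ∀ t, 0 ≤ u t) (t : ℝ) : 0 < u t + (max t 1)⁻¹ :=
  add_pos_of_nonneg_of_pos (hu0 t) (inv_pos.2 (zero_lt_one.trans_le (le_max_right _ _)))

/-- `b(t) → 0` within the positive reals. [folklore] -/
theorem tendsto_slowBase {u : ℝ → ℝ} (hu : Tendsto u atTop (𝓝 0)) (hu0 : ∀ t, 0 ≤ u t) :
    Tendsto (fun t ↦ u t + (max t 1)⁻¹) atTop (𝓝[>] 0) := by
  have hm : Tendsto (fun t : ℝ ↦ max t 1) atTop atTop := tendsto_atTop_mono (fun t ↦ le_max_left t 1) tendsto_id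
  have h0 : Tendsto (fun t ↦ u t + (max t 1)⁻¹) atTop (𝓝 0) := by
    have h := hu.add (tendsto_inv_atTop_zero.comp hm)
    rw [add_zero] at h
    exact h
  exact tendsto_nhdsWithin_iff.2 ⟨h0, Eventually.of_forall fun t ↦ slowBase_pos hu0 t⟩

/-- **The slow scale tends to infinity**: for `u → 0`, `u ≥ 0`, `p > 0`,
`σ(t) = min (max t 1) (b(t)^{-1/(2p)}) → ∞`. [folklore] -/
theorem tendsto_slowScale_atTop {u : ℝ → ℝ} (hu : Tendsto u atTop (𝓝 0)) (hu0 : ∀ t, 0 ≤ u t) {p : ℝ}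
    (hp : 0 < p) :
    Tendsto (fun t ↦ min (max t 1) ((u t + (max t 1)⁻¹) ^ (-(1 / (2 * p))))) atTop atTop := by
  have hm : Tendsto (fun t : ℝ ↦ max t 1) atTop atTop := tendsto_atTop_mono (fun t ↦ le_max_left t 1) tendsto_id
  have hc : 0 < 1 / (2 * p) := by positivity
  have h2 : Tendsto (fun t ↦ (u t + (max t 1)⁻¹) ^ (-(1 / (2 * p)))) atTop atTop := by
    have h := (tendsto_rpow_atTop hc).comp (tendsto_inv_nhdsGT_zero.comp (tendsto_slowBase hu hu0))
    refine h.congr fun t ↦ ?_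
    simp only [Function.comp_apply]
    rw [Real.rpow_neg (slowBase_pos hu0 t).le, Real.inv_rpow (slowBase_pos hu0 t).le]
  rw [Filter.tendsto_atTop] at hm h2 ⊢
  exact fun b ↦ ((hm b).and (h2 b)).mono fun t ht ↦ le_min ht.1 ht.2

/-- The slow scale is positive. [folklore] -/
theorem slowScale_pos {u : ℝ → ℝ} (hu0 : ∀ t, 0 ≤ u t) (p t : ℝ) :
    0 < min (max t 1) ((u t + (max t 1)⁻¹) ^ (-(1 / (2 * p)))) :=
  lt_min (zero_lt_one.trans_le (le_max_right _ _)) (Real.rpow_pos_of_pos (slowBase_pos hu0 t) _)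

/-- **`u σ^p ≤ √b`** for the slow scale `σ` of `u` with exponent `p > 0`. [folklore] -/
theorem mul_slowScale_rpow_le {u : ℝ → ℝ} (hu0 : ∀ t, 0 ≤ u t) {p : ℝ} (hp : 0 < p) (t : ℝ) :
    u t * (min (max t 1) ((u t + (max t 1)⁻¹) ^ (-(1 / (2 * p))))) ^ p ≤
      (u t + (max t 1)⁻¹) ^ (1 / 2 : ℝ) := by
  have hb := slowBase_pos hu0 t
  have hs0 := (slowScale_pos hu0 p t).le
  have h1 : (min (max t 1) ((u t + (max t 1)⁻¹) ^ (-(1 / (2 * p))))) ^ p ≤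
      (u t + (max t 1)⁻¹) ^ (-(1 / 2) : ℝ) := by
    refine (Real.rpow_le_rpow hs0 (min_le_right _ _) hp.le).trans (le_of_eq ?_)
    rw [← Real.rpow_mul hb.le]
    congr 1
    field_simp
  have hu_le : u t ≤ u t + (max t 1)⁻¹ := le_add_of_nonneg_right (inv_nonneg.2 (zero_le_one.trans (le_max_right _ _)))
  calc u t * (min (max t 1) ((u t + (max t 1)⁻¹) ^ (-(1 / (2 * p))))) ^ p
      ≤ (u t + (max t 1)⁻¹) * (u t + (max t 1)⁻¹) ^ (-(1 / 2) : ℝ) :=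
        mul_le_mul hu_le h1 (Real.rpow_nonneg hs0 _) hb.le
    _ = (u t + (max t 1)⁻¹) ^ (1 / 2 : ℝ) := by
        conv_lhs => rw [show (u t + (max t 1)⁻¹) = (u t + (max t 1)⁻¹) ^ (1 : ℝ) from (Real.rpow_one _).symm]
        rw [← Real.rpow_mul hb.le, one_mul, ← Real.rpow_add hb]
        norm_num

/-- **`u σ^p → 0`** for the slow scale. [folklore] -/
theorem tendsto_mul_slowScale_rpow {u : ℝ → ℝ} (hu : Tendsto u atTop (𝓝 0)) (hu0 : ∀ t, 0 ≤ u t) {p : ℝ}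
    (hp : 0 < p) :
    Tendsto (fun t ↦ u t * (min (max t 1) ((u t + (max t 1)⁻¹) ^ (-(1 / (2 * p))))) ^ p) atTop (𝓝 0) := by
  have hb0 : Tendsto (fun t ↦ u t + (max t 1)⁻¹) atTop (𝓝 0) := tendsto_nhds_of_tendsto_nhdsWithin (tendsto_slowBase hu hu0)
  have hsq : Tendsto (fun t ↦ (u t + (max t 1)⁻¹) ^ (1 / 2 : ℝ)) atTop (𝓝 0) := by
    have h := hb0.rpow_const (p := 1 / 2) (Or.inr (by norm_num))
    rwa [Real.zero_rpow (by norm_num)] at h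
  refine squeeze_zero (fun t ↦ mul_nonneg (hu0 t) (Real.rpow_nonneg (slowScale_pos hu0 p t).le _))
    (fun t ↦ mul_slowScale_rpow_le hu0 hp t) hsq

/-! ### The real-valued deviation size -/

/-- `(min F 1).toReal → 0` for `F → 0` in `ℝ≥0∞`. [folklore] -/
theorem tendsto_toReal_min_one {F : ℝ → ℝ≥0∞} (hF : Tendsto F atTop (𝓝 0)) :
    Tendsto (fun t ↦ (min (F t) 1).toReal) atTop (𝓝 0) := by
  have h1 : Tendsto (fun t ↦ min (F t) 1) atTop (𝓝 0) := by
    have h := hF.min (tendsto_const_nhds (x := (1 : ℝ≥0∞)))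
    rwa [min_eq_left (zero_le_one : (0 : ℝ≥0∞) ≤ 1)] at h
  have h := (ENNReal.tendsto_toReal ENNReal.zero_ne_top).comp h1
  simpa only [Function.comp_def, ENNReal.toReal_zero] using h

/-- When `A < 1` in `ℝ≥0∞`, `A = ofReal ((min A 1).toReal)`. [folklore] -/
theorem eq_ofReal_toReal_min_one {A : ℝ≥0∞} (h : A < 1) : A = ENNReal.ofReal ((min A 1).toReal) := by
  rw [min_eq_left h.le, ENNReal.ofReal_toReal (h.trans ENNReal.one_lt_top).ne]

/-- `min` of two functions tending to `+∞` tends to `+∞`. [folklore] -/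
theorem tendsto_min_atTop_atTop {f g : ℝ → ℝ} (hf : Tendsto f atTop atTop) (hg : Tendsto g atTop atTop) :
    Tendsto (fun t ↦ min (f t) (g t)) atTop atTop := by
  rw [Filter.tendsto_atTop] at hf hg ⊢
  exact fun b ↦ ((hf b).and (hg b)).mono fun t ht ↦ le_min ht.1 ht.2

/-- Registered sub-goal form (stub `ll_tendsto_min_atTop_atTop` of the crux item) of
`tendsto_min_atTop_atTop` (the radius `ρ₀ = min(…)` of the small spheres tends to infinity). [folklore] -/
theorem _root_.Summit.FinalStateConjecture.FinalStateConjecture.Theorems.ll_tendsto_min_atTop_atTop : ∀ {f g : ℝ → ℝ}, Filter.Tendsto f Filter.atTop Filter.atTop → Filter.Tendsto g Filter.atTop Filter.atTop → Filter.Tendsto (fun t ↦ min (f t) (g t)) Filter.atTop Filter.atTop :=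
  fun hf hg ↦ tendsto_min_atTop_atTop hf hg

end Summit.FinalStateConjecture.FinalStateConjecture.Theorems.SublinearIsFree.ChargeModel

end
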